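import Literature.Probability.Percolation.ShieldedOrientedPaths
import HarnessLib

/-!
# The weighted pair sum of BDNS Lemma 3.1: `E q^{-#O - (2d-1)#Z}` in finite horizon

Topic `Literature/Probability/Percolation`.  Sorry-free, no named facts.  This file bounds the
quantity controlling the second moment of the number of shielded oriented paths in
Bock–Damron–Newman–Sidoravicius, *Percolation of finite clusters and shielded paths*, J. Stat.
Phys. 179 (2020), §3, (3.8)–(3.15) (Lemma 3.1): for the difference chain `D` of two independent
uniform oriented walks (one step: `z ↦ z + e_{a'} - e_a`, `(a, a')` uniform) and weights `α` at
the state `0` (`α = q^{-(2d-1)}`) and `β` on `S₂ = {e_i - e_j}` (`β = q^{-1}`),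

  `phiW d α β n z = E_z ∏_{k=1}^{n} c(D_k)`,  `c(0) = α`, `c(S₂) = β`, `c = 1` elsewhere,

so that `d^{2n} · phiW d α β n 0 = Σ_{w,w'} α^{#Z_n(w,w')} β^{#O_n(w,w')}` (`sum_pow_zCount_mul_pow_oCount`).

**Main result** (`phiW_zero_le`, the finite-horizon form of Lemma 3.1): let `hS d n z`, `h0 d n z`
be the probabilities that the FIRST visit of `D` (started at `z`, times `1, …, n`) to `{0} ∪ S₂`
happens in `S₂`, resp. at `0`.  If `r` bounds `hS d n z` on `S₂` (BDNS's `p₂ - 1/d²`: return to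
`S₂` not through `0`) and `V_S, V_0` satisfy `β V_S ≥ 1`, `α V_0 ≥ 1` and the two renewal
inequalities

  `1 + (1 - 1/d)(β V_S - 1) + (1/d)(α V_0 - 1) ≤ V_0`,  `1 + r (β V_S - 1) + (1/d²)(α V_0 - 1) ≤ V_S`,

then `phiW d α β n 0 ≤ V_0` for all `n`.  (With equalities these are solved by
`V_0 = (1 - 1/d) β V_S / (1 - α/d)`, `V_S = (1 - p₂)/(1 - β f(q))`, `f(q) = (1/d)(1 - 1/d)/(dq^{2d-1} - 1) + p₂ - 1/d²`,
i.e. exactly the value `(1 - p₂)(1 - 1/d) dq^{2d-1}/(dq^{2d-1} - 1) (q - f(q))^{-1}` of Lemma 3.1; the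
two conditions `dq^{2d-1} > 1`, `f(q) < q` of the lemma are the solvability conditions.)  The proof
is the induction CLAIM(n): `phiW n z ≤ 1 + hS n z (β V_S - 1) + h0 n z (α V_0 - 1)` for all `z`,
which is the excursion decomposition (3.11)–(3.13) of the paper organised by the first step.

Also: `h0` vanishes off `{0} ∪ S₂ ∪ (one step from them)` appropriately (`h0_eq_zero_of_far`),
`h0 ≤ 1/d²` on `S₂`, `h0 d n 0 ≤ 1/d`, `hS d n 0 ≤ 1 - 1/d` ((3.8) of the paper).

## References

* B. Bock, M. Damron, C. M. Newman, V. Sidoravicius, J. Stat. Phys. 179 (2020) 789–807,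
  arXiv:1811.01678, §3, (3.8)–(3.15), Lemma 3.1. [BockEtAl2020]
-/

noncomputable section

namespace Literature.Probability.Percolation

open Finset Literature.Probability.LatticeModels

variable {d : ℕ}

/-! ### The recursions -/

/-- The one-step weight: `α` at `0`, `β` on `S₂`, `1` elsewhere. [cite: BockEtAl2020, §3 (3.8)–(3.9)] -/
def cw (α β : ℝ) (y : Site d) : ℝ := if y = 0 then α else if IsS2 y then β else 1

/-- `phiW d α β n z = E_z ∏_{k=1}^n c(D_k)` by first-step recursion. [cite: BockEtAl2020, §3 (3.9)] -/
def phiW (d : ℕ) (α β : ℝ) : ℕ → Site d → ℝ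
  | 0, _ => 1
  | n + 1, z => ((d : ℝ) ^ 2)⁻¹ * ∑ a : Fin d, ∑ a' : Fin d,
      cw α β (z + Pi.single a' 1 - Pi.single a 1) *
        phiW d α β n (z + Pi.single a' 1 - Pi.single a 1)

/-- `hS d n z = P_z(the first visit of D to {0} ∪ S₂ during [1, n] exists and is in S₂)`.
[cite: BockEtAl2020, §3 (the stopping times τ_k)] -/
def hS (d : ℕ) : ℕ → Site d → ℝ
  | 0, _ => 0
  | n + 1, z => ((d : ℝ) ^ 2)⁻¹ * ∑ a : Fin d, ∑ a' : Fin d,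
      if IsS2 (z + Pi.single a' 1 - Pi.single a 1) then 1
      else if z + Pi.single a' 1 - Pi.single a 1 = 0 then 0
      else hS d n (z + Pi.single a' 1 - Pi.single a 1)

/-- `h0 d n z = P_z(the first visit of D to {0} ∪ S₂ during [1, n] exists and is at 0)`.
[cite: BockEtAl2020, §3 (the stopping times τ_k)] -/
def h0 (d : ℕ) : ℕ → Site d → ℝ
  | 0, _ => 0
  | n + 1, z => ((d : ℝ) ^ 2)⁻¹ * ∑ a : Fin d, ∑ a' : Fin d,
      if z + Pi.single a' 1 - Pi.single a 1 = 0 then 1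
      else if IsS2 (z + Pi.single a' 1 - Pi.single a 1) then 0
      else h0 d n (z + Pi.single a' 1 - Pi.single a 1)

/-- Unfolding. [folklore] -/
@[simp] theorem phiW_zero (α β : ℝ) (z : Site d) : phiW d α β 0 z = 1 := rfl

/-- Unfolding. [folklore] -/
theorem phiW_succ (α β : ℝ) (n : ℕ) (z : Site d) :
    phiW d α β (n + 1) z = ((d : ℝ) ^ 2)⁻¹ * ∑ a : Fin d, ∑ a' : Fin d,
      cw α β (z + Pi.single a' 1 - Pi.single a 1) *
        phiW d α β n (z + Pi.single a' 1 - Pi.single a 1) := rfl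

/-- Unfolding. [folklore] -/
@[simp] theorem hS_zero (z : Site d) : hS d 0 z = 0 := rfl

/-- Unfolding. [folklore] -/
theorem hS_succ (n : ℕ) (z : Site d) :
    hS d (n + 1) z = ((d : ℝ) ^ 2)⁻¹ * ∑ a : Fin d, ∑ a' : Fin d,
      if IsS2 (z + Pi.single a' 1 - Pi.single a 1) then 1
      else if z + Pi.single a' 1 - Pi.single a 1 = 0 then 0
      else hS d n (z + Pi.single a' 1 - Pi.single a 1) := rfl

/-- Unfolding. [folklore] -/
@[simp] theorem h0_zero' (z : Site d) : h0 d 0 z = 0 := rfl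

/-- Unfolding. [folklore] -/
theorem h0_succ (n : ℕ) (z : Site d) :
    h0 d (n + 1) z = ((d : ℝ) ^ 2)⁻¹ * ∑ a : Fin d, ∑ a' : Fin d,
      if z + Pi.single a' 1 - Pi.single a 1 = 0 then 1
      else if IsS2 (z + Pi.single a' 1 - Pi.single a 1) then 0
      else h0 d n (z + Pi.single a' 1 - Pi.single a 1) := rfl

/-- `hS ≥ 0`. [folklore] -/
theorem hS_nonneg : ∀ (n : ℕ) (z : Site d), 0 ≤ hS d n z
  | 0, z => le_rfl
  | n + 1, z => by
    rw [hS_succ]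
    refine mul_nonneg (by positivity) (Finset.sum_nonneg fun a _ => Finset.sum_nonneg fun a' _ => ?_)
    split_ifs
    · exact zero_le_one
    · exact le_rfl
    · exact hS_nonneg n _

/-- `h0 ≥ 0`. [folklore] -/
theorem h0_nonneg : ∀ (n : ℕ) (z : Site d), 0 ≤ h0 d n z
  | 0, z => le_rfl
  | n + 1, z => by
    rw [h0_succ]
    refine mul_nonneg (by positivity) (Finset.sum_nonneg fun a _ => Finset.sum_nonneg fun a' _ => ?_)
    split_ifs
    · exact zero_le_one
    · exact le_rfl
    · exact h0_nonneg n _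

/-- `hS ≤ 1`. [folklore] -/
theorem hS_le_one (hd : 1 ≤ d) : ∀ (n : ℕ) (z : Site d), hS d n z ≤ 1
  | 0, z => zero_le_one
  | n + 1, z => by
    have hd0 : (0 : ℝ) < d := by exact_mod_cast hd
    rw [hS_succ]
    calc ((d : ℝ) ^ 2)⁻¹ * ∑ a : Fin d, ∑ a' : Fin d,
          (if IsS2 (z + Pi.single a' 1 - Pi.single a 1) then (1 : ℝ)
            else if z + Pi.single a' 1 - Pi.single a 1 = 0 then 0
            else hS d n (z + Pi.single a' 1 - Pi.single a 1))
        ≤ ((d : ℝ) ^ 2)⁻¹ * ∑ _a : Fin d, ∑ _a' : Fin d, (1 : ℝ) := by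
          refine mul_le_mul_of_nonneg_left
            (Finset.sum_le_sum fun a _ => Finset.sum_le_sum fun a' _ => ?_) (by positivity)
          split_ifs
          · exact le_rfl
          · exact zero_le_one
          · exact hS_le_one hd n _
      _ = 1 := by
          simp only [Finset.sum_const, Finset.card_univ, Fintype.card_fin, nsmul_eq_mul, mul_one]
          field_simp

/-! ### The values of `h0`, `hS` at `0`, on `S₂` and far away ((3.8) of the paper) -/

/-- From a state outside `{0} ∪ S₂` no step reaches `0` (`0` is entered only from `{0} ∪ S₂`).
[cite: BockEtAl2020, §3 (3.8)] -/
theorem step_ne_zero_of_far {y : Site d} (hy0 : y ≠ 0) (hyS : ¬ IsS2 y) (a a' : Fin d) :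
    y + Pi.single a' 1 - Pi.single a 1 ≠ 0 := by
  intro h
  have hy : y = Pi.single a 1 - Pi.single a' 1 := by linear_combination h
  by_cases haa : a = a'
  · subst haa
    rw [sub_self] at hy
    exact hy0 hy
  · exact hyS ⟨a, a', haa, hy⟩

/-- **`h0` vanishes away from `{0} ∪ S₂`**: from far away the first visit to `{0} ∪ S₂` is in `S₂`.
[cite: BockEtAl2020, §3 (3.8)] -/
theorem h0_eq_zero_of_far : ∀ (n : ℕ) {y : Site d}, y ≠ 0 → ¬ IsS2 y → h0 d n y = 0
  | 0, _, _, _ => rfl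
  | n + 1, y, hy0, hyS => by
    rw [h0_succ]
    refine mul_eq_zero_of_right _ (Finset.sum_eq_zero fun a _ => Finset.sum_eq_zero fun a' _ => ?_)
    rw [if_neg (step_ne_zero_of_far hy0 hyS a a')]
    split_ifs with h
    · rfl
    · exact h0_eq_zero_of_far n (step_ne_zero_of_far hy0 hyS a a') h

/-- `h0 d n z ≤ 1/d²` on `S₂` (`P(h' = 0 | h = 2) = 1/d²`). [cite: BockEtAl2020, §3 (3.8)] -/
theorem h0_le_of_isS2 (hd : 1 ≤ d) : ∀ (n : ℕ) {z : Site d}, IsS2 z → h0 d n z ≤ 1 / (d : ℝ) ^ 2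
  | 0, z, _ => by rw [h0_zero']; positivity
  | n + 1, z, hz => by
    have hd0 : (0 : ℝ) < d := by exact_mod_cast hd
    obtain ⟨i, j, hij, rfl⟩ := hz
    rw [h0_succ]
    have hterm : ∀ a a' : Fin d,
        (if Pi.single i 1 - Pi.single j 1 + Pi.single a' 1 - Pi.single a 1 = (0 : Site d) then (1 : ℝ)
          else if IsS2 (Pi.single i 1 - Pi.single j 1 + Pi.single a' 1 - Pi.single a 1) then 0
          else h0 d n (Pi.single i 1 - Pi.single j 1 + Pi.single a' 1 - Pi.single a 1)) ≤
        (if a' = j ∧ a = i then (1 : ℝ) else 0) := by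
      intro a a'
      by_cases h1 : Pi.single i 1 - Pi.single j 1 + Pi.single a' 1 - Pi.single a 1 = (0 : Site d)
      · rw [if_pos h1, if_pos ((succ_S2_eq_zero_iff hij a' a).1 h1)]
      · rw [if_neg h1]
        split_ifs with h2 h3
        · exact zero_le_one
        · exact le_rfl
        · exact (h0_eq_zero_of_far n h1 h2).le.trans zero_le_one
        · exact (h0_eq_zero_of_far n h1 h2).le
    calc ((d : ℝ) ^ 2)⁻¹ * ∑ a : Fin d, ∑ a' : Fin d, _
        ≤ ((d : ℝ) ^ 2)⁻¹ * ∑ a : Fin d, ∑ a' : Fin d, (if a' = j ∧ a = i then (1 : ℝ) else 0) :=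
          mul_le_mul_of_nonneg_left
            (Finset.sum_le_sum fun a _ => Finset.sum_le_sum fun a' _ => hterm a a') (by positivity)
      _ ≤ ((d : ℝ) ^ 2)⁻¹ * 1 := by
          refine mul_le_mul_of_nonneg_left ?_ (by positivity)
          rw [Finset.sum_comm]
          exact sum_sum_boole_pair_le j i
      _ = 1 / (d : ℝ) ^ 2 := by rw [mul_one, one_div]

/-- `h0 d n 0 ≤ 1/d` (`P(h' = 0 | h = 0) = 1/d`). [cite: BockEtAl2020, §3 (3.8)] -/
theorem h0_zero_le (hd : 1 ≤ d) (n : ℕ) : h0 d n (0 : Site d) ≤ 1 / d := by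
  have hd0 : (0 : ℝ) < d := by exact_mod_cast hd
  cases n with
  | zero => rw [h0_zero']; positivity
  | succ n =>
    rw [h0_succ]
    have hterm : ∀ a a' : Fin d,
        (if (0 : Site d) + Pi.single a' 1 - Pi.single a 1 = 0 then (1 : ℝ)
          else if IsS2 ((0 : Site d) + Pi.single a' 1 - Pi.single a 1) then 0
          else h0 d n ((0 : Site d) + Pi.single a' 1 - Pi.single a 1)) ≤
        (if a' = a then (1 : ℝ) else 0) := by
      intro a a'
      rw [zero_add]
      by_cases h : a' = a
      · subst h
        simp
      · rw [if_neg (fun h' => h (single_sub_single_eq_zero_iff.1 h')),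
          if_pos (isS2_single_sub_single h), if_neg h]
    calc ((d : ℝ) ^ 2)⁻¹ * ∑ a : Fin d, ∑ a' : Fin d, _
        ≤ ((d : ℝ) ^ 2)⁻¹ * ∑ a : Fin d, ∑ a' : Fin d, (if a' = a then (1 : ℝ) else 0) :=
          mul_le_mul_of_nonneg_left
            (Finset.sum_le_sum fun a _ => Finset.sum_le_sum fun a' _ => hterm a a') (by positivity)
      _ = 1 / d := by
          simp only [Finset.sum_ite_eq', Finset.mem_univ, if_true, Finset.sum_const, Finset.card_univ,
            Fintype.card_fin, nsmul_eq_mul, mul_one]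
          field_simp

/-- `hS d n 0 ≤ 1 - 1/d` (`P(h' = 2 | h = 0) = 1 - 1/d`). [cite: BockEtAl2020, §3 (3.8)] -/
theorem hS_zero_le (hd : 1 ≤ d) (n : ℕ) : hS d n (0 : Site d) ≤ 1 - 1 / d := by
  have hd0 : (0 : ℝ) < d := by exact_mod_cast hd
  have hnn : (0 : ℝ) ≤ 1 - 1 / d := by
    rw [sub_nonneg, div_le_one hd0]; exact_mod_cast hd
  cases n with
  | zero => rw [hS_zero]; exact hnn
  | succ n =>
    rw [hS_succ]
    have hterm : ∀ a a' : Fin d,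
        (if IsS2 ((0 : Site d) + Pi.single a' 1 - Pi.single a 1) then (1 : ℝ)
          else if (0 : Site d) + Pi.single a' 1 - Pi.single a 1 = 0 then 0
          else hS d n ((0 : Site d) + Pi.single a' 1 - Pi.single a 1)) ≤
        (if a' = a then (0 : ℝ) else 1) := by
      intro a a'
      rw [zero_add]
      by_cases h : a' = a
      · subst h
        rw [sub_self, if_neg (fun h' => IsS2.ne_zero h' rfl), if_pos rfl, if_pos rfl]
      · rw [if_pos (isS2_single_sub_single h), if_neg h]
    calc ((d : ℝ) ^ 2)⁻¹ * ∑ a : Fin d, ∑ a' : Fin d, _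
        ≤ ((d : ℝ) ^ 2)⁻¹ * ∑ a : Fin d, ∑ a' : Fin d, (if a' = a then (0 : ℝ) else 1) :=
          mul_le_mul_of_nonneg_left
            (Finset.sum_le_sum fun a _ => Finset.sum_le_sum fun a' _ => hterm a a') (by positivity)
      _ = 1 - 1 / d := by
          have h : ∀ a a' : Fin d, (if a' = a then (0 : ℝ) else 1) = 1 - (if a' = a then 1 else 0) := by
            intro a a'; split_ifs <;> norm_num
          simp only [h, Finset.sum_sub_distrib, Finset.sum_ite_eq', Finset.mem_univ, if_true,
            Finset.sum_const, Finset.card_univ, Fintype.card_fin, nsmul_eq_mul, mul_one]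
          field_simp

/-! ### CLAIM(n): the excursion decomposition as an induction -/

/-- **CLAIM(n)** (BDNS (3.11)–(3.13) by first-step induction): if `βV_S ≥ 1`, `αV_0 ≥ 1`, `hS ≤ r`
on `S₂`, and `V_0, V_S` satisfy the two renewal inequalities, then for every `n` and `z`,
`phiW n z ≤ 1 + hS n z (βV_S - 1) + h0 n z (αV_0 - 1)`. [cite: BockEtAl2020, §3 (3.11)–(3.13)] -/
theorem phiW_le (hd : 1 ≤ d) {α β r VS V0 : ℝ} (hα0 : 0 ≤ α) (hβ0 : 0 ≤ β)
    (hβ : 1 ≤ β * VS) (hα : 1 ≤ α * V0)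
    (hr : ∀ (n : ℕ) (z : Site d), IsS2 z → hS d n z ≤ r)
    (h0cond : 1 + (1 - 1 / d) * (β * VS - 1) + (1 / d) * (α * V0 - 1) ≤ V0)
    (hScond : 1 + r * (β * VS - 1) + (1 / (d : ℝ) ^ 2) * (α * V0 - 1) ≤ VS) :
    ∀ (n : ℕ) (z : Site d),
      phiW d α β n z ≤ 1 + hS d n z * (β * VS - 1) + h0 d n z * (α * V0 - 1)
  | 0, z => by simp
  | n + 1, z => by
    have hβ' : 0 ≤ β * VS - 1 := sub_nonneg.2 hβ
    have hα' : 0 ≤ α * V0 - 1 := sub_nonneg.2 hα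
    -- the value at `0` and on `S₂` after `n` steps
    have hV0 : phiW d α β n 0 ≤ V0 := by
      calc phiW d α β n 0 ≤ 1 + hS d n 0 * (β * VS - 1) + h0 d n 0 * (α * V0 - 1) := phiW_le hd hα0 hβ0 hβ hα hr h0cond hScond n 0
        _ ≤ 1 + (1 - 1 / d) * (β * VS - 1) + (1 / d) * (α * V0 - 1) := by
            gcongr
            · exact hS_zero_le hd n
            · exact h0_zero_le hd n
        _ ≤ V0 := h0cond
    have hVS : ∀ y : Site d, IsS2 y → phiW d α β n y ≤ VS := by
      intro y hy
      calc phiW d α β n y ≤ 1 + hS d n y * (β * VS - 1) + h0 d n y * (α * V0 - 1) :=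
            phiW_le hd hα0 hβ0 hβ hα hr h0cond hScond n y
        _ ≤ 1 + r * (β * VS - 1) + (1 / (d : ℝ) ^ 2) * (α * V0 - 1) := by
            gcongr
            · exact hr n y hy
            · exact h0_le_of_isS2 hd n hy
        _ ≤ VS := hScond
    -- termwise comparison of the three recursions
    rw [phiW_succ, hS_succ, h0_succ]
    have hterm : ∀ a a' : Fin d,
        cw α β (z + Pi.single a' 1 - Pi.single a 1) * phiW d α β n (z + Pi.single a' 1 - Pi.single a 1) ≤
          1 + (if IsS2 (z + Pi.single a' 1 - Pi.single a 1) then 1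
                else if z + Pi.single a' 1 - Pi.single a 1 = 0 then 0
                else hS d n (z + Pi.single a' 1 - Pi.single a 1)) * (β * VS - 1) +
            (if z + Pi.single a' 1 - Pi.single a 1 = 0 then 1
              else if IsS2 (z + Pi.single a' 1 - Pi.single a 1) then 0
              else h0 d n (z + Pi.single a' 1 - Pi.single a 1)) * (α * V0 - 1) := by
      intro a a'
      set y := z + Pi.single a' 1 - Pi.single a 1 with hy
      by_cases hy0 : y = 0
      · have hyS : ¬ IsS2 y := fun h => h.ne_zero hy0
        rw [cw, if_pos hy0, if_neg hyS, if_pos hy0, if_pos hy0, hy0]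
        have := mul_le_mul_of_nonneg_left hV0 hα0
        linarith
      · by_cases hyS : IsS2 y
        · rw [cw, if_neg hy0, if_pos hyS, if_pos hyS, if_neg hy0, if_pos hyS]
          nlinarith [hVS y hyS, hβ']
        · rw [cw, if_neg hy0, if_neg hyS, if_neg hyS, if_neg hy0, if_neg hy0, if_neg hyS, one_mul]
          exact phiW_le hd hα0 hβ0 hβ hα hr h0cond hScond n y
    calc ((d : ℝ) ^ 2)⁻¹ * ∑ a : Fin d, ∑ a' : Fin d,
          cw α β (z + Pi.single a' 1 - Pi.single a 1) * phiW d α β n (z + Pi.single a' 1 - Pi.single a 1)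
        ≤ ((d : ℝ) ^ 2)⁻¹ * ∑ a : Fin d, ∑ a' : Fin d,
            (1 + (if IsS2 (z + Pi.single a' 1 - Pi.single a 1) then 1
                  else if z + Pi.single a' 1 - Pi.single a 1 = 0 then 0
                  else hS d n (z + Pi.single a' 1 - Pi.single a 1)) * (β * VS - 1) +
              (if z + Pi.single a' 1 - Pi.single a 1 = 0 then 1
                else if IsS2 (z + Pi.single a' 1 - Pi.single a 1) then 0
                else h0 d n (z + Pi.single a' 1 - Pi.single a 1)) * (α * V0 - 1)) :=
          mul_le_mul_of_nonneg_left
            (Finset.sum_le_sum fun a _ => Finset.sum_le_sum fun a' _ => hterm a a') (by positivity)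
      _ = 1 + ((d : ℝ) ^ 2)⁻¹ * (∑ a : Fin d, ∑ a' : Fin d,
            (if IsS2 (z + Pi.single a' 1 - Pi.single a 1) then 1
              else if z + Pi.single a' 1 - Pi.single a 1 = 0 then 0
              else hS d n (z + Pi.single a' 1 - Pi.single a 1))) * (β * VS - 1) +
          ((d : ℝ) ^ 2)⁻¹ * (∑ a : Fin d, ∑ a' : Fin d,
            (if z + Pi.single a' 1 - Pi.single a 1 = 0 then 1
              else if IsS2 (z + Pi.single a' 1 - Pi.single a 1) then 0
              else h0 d n (z + Pi.single a' 1 - Pi.single a 1))) * (α * V0 - 1) := by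
          have hd0 : (d : ℝ) ≠ 0 := by exact_mod_cast (show d ≠ 0 by omega)
          simp only [Finset.sum_add_distrib, ← Finset.sum_mul, Finset.sum_const, Finset.card_univ,
            Fintype.card_fin, nsmul_eq_mul]
          field_simp

/-- **BDNS Lemma 3.1, finite horizon**: under the hypotheses of `phiW_le`,
`E_0 ∏_{k=1}^n c(D_k) = phiW d α β n 0 ≤ V_0` for every `n`. [cite: BockEtAl2020, §3 Lemma 3.1] -/
theorem phiW_zero_le (hd : 1 ≤ d) {α β r VS V0 : ℝ} (hα0 : 0 ≤ α) (hβ0 : 0 ≤ β)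
    (hβ : 1 ≤ β * VS) (hα : 1 ≤ α * V0)
    (hr : ∀ (n : ℕ) (z : Site d), IsS2 z → hS d n z ≤ r)
    (h0cond : 1 + (1 - 1 / d) * (β * VS - 1) + (1 / d) * (α * V0 - 1) ≤ V0)
    (hScond : 1 + r * (β * VS - 1) + (1 / (d : ℝ) ^ 2) * (α * V0 - 1) ≤ VS) (n : ℕ) :
    phiW d α β n (0 : Site d) ≤ V0 := by
  have hβ' : 0 ≤ β * VS - 1 := sub_nonneg.2 hβ
  have hα' : 0 ≤ α * V0 - 1 := sub_nonneg.2 hα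
  calc phiW d α β n 0 ≤ 1 + hS d n 0 * (β * VS - 1) + h0 d n 0 * (α * V0 - 1) :=
        phiW_le hd hα0 hβ0 hβ hα hr h0cond hScond n 0
    _ ≤ 1 + (1 - 1 / d) * (β * VS - 1) + (1 / d) * (α * V0 - 1) := by
        gcongr
        · exact hS_zero_le hd n
        · exact h0_zero_le hd n
    _ ≤ V0 := h0cond

/-! ### Link with the pair sum `Σ_{w,w'} α^{#Z_n} β^{#O_n}` -/

variable {n : ℕ}

/-- The weight as a product of powers of the two indicators. [folklore] -/
theorem cw_eq_pow_mul_pow (α β : ℝ) (y : Site d) :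
    cw α β y = α ^ (if y = 0 then 1 else 0) * β ^ (if IsS2 y then 1 else 0) := by
  unfold cw
  by_cases h0 : y = 0
  · subst h0
    have : ¬ IsS2 (0 : Site d) := fun h => h.ne_zero rfl
    simp [this]
  · by_cases hS : IsS2 y
    · simp [h0, hS]
    · simp [h0, hS]

/-- The weighted pair sum with offset `z`: `Σ_{w,w'} ∏_{k=1}^{n} c(z + D_k(w,w'))`,
`D_k = opos w' k - opos w k`. [cite: BockEtAl2020, §3 (3.9)] -/
def pairWeightSum (d : ℕ) (α β : ℝ) (n : ℕ) (z : Site d) : ℝ :=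
  ∑ w : Fin n → Fin d, ∑ w' : Fin n → Fin d,
    ∏ k : Fin n, cw α β (z + (opos w' ((k : ℕ) + 1) - opos w ((k : ℕ) + 1)))

/-- First-step decomposition of the weighted pair sum. [cite: BockEtAl2020, §3 (3.9)] -/
theorem pairWeightSum_succ (α β : ℝ) (n : ℕ) (z : Site d) :
    pairWeightSum d α β (n + 1) z = ∑ a : Fin d, ∑ a' : Fin d,
      cw α β (z + Pi.single a' 1 - Pi.single a 1) *
        pairWeightSum d α β n (z + Pi.single a' 1 - Pi.single a 1) := by
  rw [pairWeightSum, sum_wordPair_succ]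
  refine Finset.sum_congr rfl fun a _ => Finset.sum_congr rfl fun a' _ => ?_
  rw [pairWeightSum, Finset.mul_sum]
  refine Finset.sum_congr rfl fun v _ => ?_
  rw [Finset.mul_sum]
  refine Finset.sum_congr rfl fun v' _ => ?_
  rw [Fin.prod_univ_succ]
  congr 1
  · rw [Fin.val_zero, opos_cons_succ, opos_cons_succ, opos_zero, opos_zero]
    congr 1
    abel
  · refine Finset.prod_congr rfl fun k _ => ?_
    rw [Fin.val_succ, opos_cons_succ, opos_cons_succ]
    congr 1
    abel

/-- `pairWeightSum d α β n z = d^{2n} · phiW d α β n z`. [cite: BockEtAl2020, §3 (3.9)] -/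
theorem pairWeightSum_eq (hd : 1 ≤ d) (α β : ℝ) : ∀ (n : ℕ) (z : Site d),
    pairWeightSum d α β n z = (d : ℝ) ^ (2 * n) * phiW d α β n z
  | 0, z => by simp [pairWeightSum]
  | n + 1, z => by
    have hd0 : (d : ℝ) ≠ 0 := by exact_mod_cast (show d ≠ 0 by omega)
    rw [pairWeightSum_succ, phiW_succ, ← mul_assoc,
      show (d : ℝ) ^ (2 * (n + 1)) * ((d : ℝ) ^ 2)⁻¹ = (d : ℝ) ^ (2 * n) by field_simp; ring,
      Finset.mul_sum]
    refine Finset.sum_congr rfl fun a _ => ?_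
    rw [Finset.mul_sum]
    refine Finset.sum_congr rfl fun a' _ => ?_
    rw [pairWeightSum_eq hd α β n]
    ring

/-- **The second-moment weight sum**: `Σ_{w,w'} α^{#Z_n(w,w')} β^{#O_n(w,w')} = d^{2n} phiW d α β n 0`.
[cite: BockEtAl2020, §3 (3.9)] -/
theorem sum_pow_zCount_mul_pow_oCount (hd : 1 ≤ d) (α β : ℝ) (n : ℕ) :
    ∑ w : Fin n → Fin d, ∑ w' : Fin n → Fin d, α ^ zCount w w' * β ^ oCount w w' =
      (d : ℝ) ^ (2 * n) * phiW d α β n 0 := by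
  rw [← pairWeightSum_eq hd, pairWeightSum]
  refine Finset.sum_congr rfl fun w _ => Finset.sum_congr rfl fun w' _ => ?_
  simp only [zero_add, cw_eq_pow_mul_pow, Finset.prod_mul_distrib, Finset.prod_pow_eq_pow_sum]
  congr 1
  · rw [zCount, Finset.card_filter]
    congr 1
    refine Finset.sum_congr rfl fun k _ => ?_
    simp only [sub_eq_zero]
    by_cases h : opos w' ((k : ℕ) + 1) = opos w ((k : ℕ) + 1)
    · rw [if_pos h, if_pos h.symm]
    · rw [if_neg h, if_neg (fun h' => h h'.symm)]
  · rw [oCount, Finset.card_filter]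

end Literature.Probability.Percolation

end
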